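import Mathlib
import Summits.Ventures.PercRepro2.ZMeanProof

/-!
# A sure edge identifies its endpoints (blind cell PercRepro2, night-1 g9; NIGHT1-G9.md §9)

If the edge `f = {x, y}` has weight `1`, the mark `a₃ = x` may be replaced by `a₃ = y` in the
cleared mean field: every event of `HMFc` sees only connectivity, `x ↔ y` is sure, and the
clusters of `x` and `y` coincide — `HMFc p ends o a₁ a₂ x b = HMFc p ends o a₁ a₂ y b`
(`HMFc_sure`), so `HMF … x b ↔ HMF … y b` (`HMF_sure_iff`).  This is the formal content of
«the face `s = 1` of a class with the coin `s` on `{a₃, b}` is the coincidence `a₃ = b`».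
-/

namespace Summit.Ventures.PercRepro2

open UnionCluster CovForm

namespace SureEdge

section Conn

variable {V : Type*} {E : Type*} {ends : E → Sym2 V} {f : E} {x y : V} (hxy : ends f = s(x, y))
include hxy

/-- On `{f open}` the endpoints of `f` are connected to the same vertices. -/
lemma conn_iff {ω : Config E} (hω : ω f = true) (z : V) :
    Conn ends ω x z ↔ Conn ends ω y z := by
  have h : Conn ends ω x y := conn_of_openAdj ⟨f, hω, hxy⟩
  exact ⟨fun h' => conn_trans (conn_symm h) h', fun h' => conn_trans h h'⟩

/-- On `{f open}` the endpoints of `f` have the same cluster. -/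
lemma cluster_eq {ω : Config E} (hω : ω f = true) : cluster ends ω x = cluster ends ω y := by
  ext z
  simp only [mem_cluster]
  exact conn_iff hxy hω z

/-- `{C(x) = S} ∩ {f open} = {C(y) = S} ∩ {f open}`. -/
lemma clusterEvent_inter_open (S : Set V) :
    clusterEvent ends x S ∩ openEdge f = clusterEvent ends y S ∩ openEdge f := by
  ext ω
  simp only [Set.mem_inter_iff, mem_clusterEvent, mem_openEdge]
  constructor
  · rintro ⟨h, hω⟩; exact ⟨by rw [← cluster_eq hxy hω, h], hω⟩
  · rintro ⟨h, hω⟩; exact ⟨by rw [cluster_eq hxy hω, h], hω⟩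

/-- `PD(a₁, a₂, x) ∩ {f open} = PD(a₁, a₂, y) ∩ {f open}`. -/
lemma PD_inter_open (a₁ a₂ : V) (Z : Set (Config E)) :
    PDEvent ends a₁ a₂ x ∩ Z ∩ openEdge f = PDEvent ends a₁ a₂ y ∩ Z ∩ openEdge f := by
  ext ω
  simp only [PDEvent, Dtilde, UnionCluster.inU, Set.mem_inter_iff, Set.mem_compl_iff,
    Set.mem_union, mem_connEvent, mem_openEdge]
  constructor
  · rintro ⟨⟨⟨hQ, h⟩, hZ⟩, hω⟩
    exact ⟨⟨⟨hQ, by rwa [← conn_iff hxy hω a₁, ← conn_iff hxy hω a₂]⟩, hZ⟩, hω⟩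
  · rintro ⟨⟨⟨hQ, h⟩, hZ⟩, hω⟩
    exact ⟨⟨⟨hQ, by rwa [conn_iff hxy hω a₁, conn_iff hxy hω a₂]⟩, hZ⟩, hω⟩

/-- `T(a₁, a₂, x) ∩ {f open} = T(a₁, a₂, y) ∩ {f open}`. -/
lemma T_inter_open (a₁ a₂ : V) (Z : Set (Config E)) :
    TEvent ends a₁ a₂ x ∩ Z ∩ openEdge f = TEvent ends a₁ a₂ y ∩ Z ∩ openEdge f := by
  ext ω
  simp only [TEvent, Set.mem_inter_iff, Set.mem_compl_iff, mem_connEvent, mem_openEdge]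
  constructor
  · rintro ⟨⟨⟨hQ, h⟩, hZ⟩, hω⟩
    exact ⟨⟨⟨hQ, (conn_iff hxy hω a₂).1 (conn_symm h) |> conn_symm⟩, hZ⟩, hω⟩
  · rintro ⟨⟨⟨hQ, h⟩, hZ⟩, hω⟩
    exact ⟨⟨⟨hQ, (conn_iff hxy hω a₂).2 (conn_symm h) |> conn_symm⟩, hZ⟩, hω⟩

end Conn

section Prob

variable {V : Type*} {E : Type*} [Fintype E] [DecidableEq E] [Fintype V] [DecidableEq V]
  {R : Type*} [Field R] [LinearOrder R] [IsStrictOrderedRing R]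

variable (p : E → R) {ends : E → Sym2 V} {f : E} {x y : V} (hf : p f = 1) (hxy : ends f = s(x, y))
include hf

omit [Fintype V] [DecidableEq V] [LinearOrder R] [IsStrictOrderedRing R] in
/-- Under `p f = 1` the event `{f open}` is sure. -/
lemma prob_inter_open (A : Set (Config E)) : prob p (A ∩ openEdge f) = prob p A := by
  have h := prob_update_one_inter_openEdge p A f
  rwa [← hf, Function.update_eq_self f p] at h

omit [Fintype V] [DecidableEq V] [LinearOrder R] [IsStrictOrderedRing R] in
/-- Two events agreeing on `{f open}` have the same probability. -/
lemma prob_congr {A B : Set (Config E)} (h : A ∩ openEdge f = B ∩ openEdge f) :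
    prob p A = prob p B := by
  rw [← prob_inter_open p hf A, h, prob_inter_open p hf B]

include hxy

omit [Fintype V] [DecidableEq V] [LinearOrder R] [IsStrictOrderedRing R] in
/-- `P(PD(x) ∩ Z) = P(PD(y) ∩ Z)`. -/
lemma prob_PD (a₁ a₂ : V) (Z : Set (Config E)) :
    prob p (PDEvent ends a₁ a₂ x ∩ Z) = prob p (PDEvent ends a₁ a₂ y ∩ Z) :=
  prob_congr p hf (PD_inter_open hxy a₁ a₂ Z)

omit [Fintype V] [DecidableEq V] [LinearOrder R] [IsStrictOrderedRing R] in
/-- `P(PD(x)) = P(PD(y))`. -/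
lemma prob_PD' (a₁ a₂ : V) :
    prob p (PDEvent ends a₁ a₂ x) = prob p (PDEvent ends a₁ a₂ y) := by
  have := prob_PD p hf hxy a₁ a₂ Set.univ
  simpa only [Set.inter_univ] using this

omit [Fintype V] [DecidableEq V] [LinearOrder R] [IsStrictOrderedRing R] in
/-- `P(T(x) ∩ Z) = P(T(y) ∩ Z)`. -/
lemma prob_T (a₁ a₂ : V) (Z : Set (Config E)) :
    prob p (TEvent ends a₁ a₂ x ∩ Z) = prob p (TEvent ends a₁ a₂ y ∩ Z) :=
  prob_congr p hf (T_inter_open hxy a₁ a₂ Z)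

omit [Fintype V] [DecidableEq V] [LinearOrder R] [IsStrictOrderedRing R] in
/-- `P(T(x)) = P(T(y))`. -/
lemma prob_T' (a₁ a₂ : V) :
    prob p (TEvent ends a₁ a₂ x) = prob p (TEvent ends a₁ a₂ y) := by
  have := prob_T p hf hxy a₁ a₂ Set.univ
  simpa only [Set.inter_univ] using this

omit [Fintype V] [DecidableEq V] [LinearOrder R] [IsStrictOrderedRing R] in
/-- `P(Z ∩ T(x)) = P(Z ∩ T(y))`. -/
lemma prob_T'' (a₁ a₂ : V) (Z : Set (Config E)) :
    prob p (Z ∩ TEvent ends a₁ a₂ x) = prob p (Z ∩ TEvent ends a₁ a₂ y) := by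
  rw [Set.inter_comm, prob_T p hf hxy, Set.inter_comm]

omit [Fintype V] [DecidableEq V] [LinearOrder R] [IsStrictOrderedRing R] in
/-- `P(C(x) = S) = P(C(y) = S)`. -/
lemma prob_clusterEvent (S : Set V) :
    prob p (clusterEvent ends x S) = prob p (clusterEvent ends y S) :=
  prob_congr p hf (clusterEvent_inter_open hxy S)

omit [LinearOrder R] [IsStrictOrderedRing R] in
/-- The mean field with `a₃ = x` is the mean field with `a₃ = y`. -/
lemma Xhat_sure (o a₁ a₂ b : V) :
    Xhat p ends o a₁ a₂ x b = Xhat p ends o a₁ a₂ y b := by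
  rw [Xhat_eq_sum, Xhat_eq_sum]
  exact Finset.sum_congr rfl fun W _ => by rw [prob_clusterEvent p hf hxy]

omit [LinearOrder R] [IsStrictOrderedRing R] in
/-- **A sure edge identifies its endpoints in the cleared mean field.** -/
theorem HMFc_sure (o a₁ a₂ b : V) :
    HMFc p ends o a₁ a₂ x b = HMFc p ends o a₁ a₂ y b := by
  unfold HMFc CovForm.marginC CovForm.DEF CovForm.EQo CovForm.EQ3 CovForm.EQ3o CovForm.Do massM2
    deltaT CovForm.gap
  simp only [prob_PD p hf hxy, prob_PD' p hf hxy, prob_T p hf hxy, prob_T' p hf hxy,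
    prob_T'' p hf hxy, Xhat_sure p hf hxy]

omit [IsStrictOrderedRing R] in
/-- **(HMF) with `a₃ = x` is (HMF) with `a₃ = y` when `{x, y}` is a sure edge.** -/
theorem HMF_sure_iff (o a₁ a₂ b : V) :
    HMF p ends o a₁ a₂ x b ↔ HMF p ends o a₁ a₂ y b := by
  unfold HMF
  rw [HMFc_sure p hf hxy]

end Prob

end SureEdge

end Summit.Ventures.PercRepro2
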